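import Literature.NumberTheory.GaloisRepresentations.PairingExactAnnihilatorProofs
import HarnessLib

/-!
# Lagrangian subgroups of a finite group with a perfect pairing: uniqueness of the exact self-annihilator, and the
# two isotropic lines of a hyperbolic plane (theorems only)

Topic `NumberTheory/GaloisRepresentations` (companion of `PairingExactAnnihilatorProofs`, same conventions: a bi-additive
pairing `b : X × X → ℤ/n` of a finite `n`-torsion group with injective adjoints; annihilators as `⨅ s ∈ S, (b s).ker`).
THEOREMS ONLY (no definition, no named fact, no instance, no `sorry`).

The use (cell `pub/bsd-print-x9`, Howard's hypothesis H.5(b) at an ANOMALOUS place `v ∣ p`, memo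
`HOME/x10b-p1-w5/H5B-AT-P-ANOMALOUS-ANALYSIS-w5g2.md` §1/§2/§6 and lit DOSSIER v36 §62.2): on `X = H¹(K_v, E[p])` with the
Weil cup product, the residual images `R_v(ψ)`, `R_v(ψ⁻¹)` of the ordinary condition are MUTUALLY exact annihilators
(from H.4) of the same size; H.5(b) at `v` says they are EQUAL, which holds iff one of them is isotropic (§1); and when
`E(K_v)[p] = 0` the plane `H¹(K_v, E[p])` carries exactly two isotropic lines (§2), so an isotropic line other than the
image of `H¹(K_v, Fil_v E[p])` is determined.

* §1 **`eq_of_isotropic_of_orthogonal_of_card`** — `S ⊥ T`, `S ⊥ S`, `#S · #T = #X`, `#S = #T` ⇒ `S = T` (both are the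
  right annihilator of `S`, by `mem_iff_forall_of_isotropic_of_card`); `_comp` version for a pairing into any group read
  through a character `ω`.
* §2 **`eq_of_isotropic_of_ne_of_card_eq_sq`** — `#X = p²` (`p` an odd prime, `X` killed by `p`), `b` SYMMETRIC with
  injective adjoint, `M` an isotropic subgroup of order `p`: two isotropic subgroups `S, T` of order `p` different from `M`
  coincide («a hyperbolic plane has exactly two isotropic lines»: with `X = ℤ/p·e ⊕ ℤ/p·s`, `b(e,e) = b(s,s) = 0`,
  `β = b(e,s) ≠ 0`, an element `i e + j s` with `j ≢ 0` is isotropic iff `2 i j β = 0` iff `i ≡ 0`).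

References: [MilneADT2006] J. S. Milne, *Arithmetic Duality Theorems*, I §0 (Prop. 0.19), I Cor. 2.3;
[Serre1973] J.-P. Serre, *A Course in Arithmetic*, Ch. IV §1.3 (hyperbolic planes, isotropic vectors);
[Howard2004HeegnerKolyvagin] §1.3, H.4/H.5.  BSD is not proved by any of this.
-/

set_option autoImplicit false

noncomputable section

open Function

namespace Literature.NumberTheory.GaloisRepresentations

/-! ## §1 Uniqueness of the Lagrangian partner -/

section Lagrangian

variable {X : Type*} [AddCommGroup X] [Finite X] {n : ℕ} [NeZero n]
  (b : X →+ X →+ ZMod n) (hX : ∀ x : X, n • x = 0) (hinjL : Injective b) (hinjR : Injective b.flip)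

include hX hinjL hinjR in
/-- **Two mutually orthogonal subgroups of complementary size, one of them isotropic and both of the same size, are
equal.**  If `b(S, T) = 0`, `b(S, S) = 0`, `#S · #T = #X` and `#S = #T`, then `S = T`: by
`mem_iff_forall_of_isotropic_of_card` both `T` and `S` are the right annihilator of `S`.  (The residual form of Howard's
H.5(b) at a place where H.4 holds: `R_v(ψ⁻¹) = R_v(ψ)^⊥`, so `R_v(ψ) = R_v(ψ⁻¹)` iff `R_v(ψ)` is isotropic.)
[cite: MilneADT2006, Ch. I §0, Prop. 0.19] [cite: Howard2004HeegnerKolyvagin, §1.3 (H.4, H.5)] -/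
theorem eq_of_isotropic_of_orthogonal_of_card (S T : AddSubgroup X) (hST : ∀ s ∈ S, ∀ t ∈ T, b s t = 0)
    (hSS : ∀ s ∈ S, ∀ s' ∈ S, b s s' = 0) (hcard : Nat.card S * Nat.card T = Nat.card X)
    (hST' : Nat.card S = Nat.card T) : S = T := by
  have hT := (mem_iff_forall_of_isotropic_of_card b hX hX hinjL hinjR S T hST hcard).2
  have hS := (mem_iff_forall_of_isotropic_of_card b hX hX hinjL hinjR S S hSS (by rw [← hST'] at hcard; exact hcard)).2
  ext y
  rw [hS y, hT y]

end Lagrangian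

section LagrangianComp

variable {X Q : Type*} [AddCommGroup X] [AddCommGroup Q] [Finite X] {n : ℕ} [NeZero n]
  (c : X →+ X →+ Q) (ω : Q →+ ZMod n) (hX : ∀ x : X, n • x = 0)
  (hinjL : Injective (c.compr₂ ω)) (hinjR : Injective (c.compr₂ ω).flip)

include hX hinjL hinjR in
/-- §1 for a pairing `c : X × X → Q` into any group that is perfect after a character `ω : Q → ℤ/n` (e.g. a cup product
with values in `H²(K_v, μ_p)` read through the invariant map): `c(S, T) = 0`, `c(S, S) = 0`, `#S · #T = #X`, `#S = #T`
⇒ `S = T`. [cite: MilneADT2006, Ch. I §0, Prop. 0.19] [cite: Howard2004HeegnerKolyvagin, §1.3 (H.4, H.5)] -/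
theorem eq_of_isotropic_of_orthogonal_of_card_comp (S T : AddSubgroup X) (hST : ∀ s ∈ S, ∀ t ∈ T, c s t = 0)
    (hSS : ∀ s ∈ S, ∀ s' ∈ S, c s s' = 0) (hcard : Nat.card S * Nat.card T = Nat.card X)
    (hST' : Nat.card S = Nat.card T) : S = T := by
  have hb : ∀ (x : X) (y : X), (c.compr₂ ω) x y = ω (c x y) := fun _ _ ↦ rfl
  exact eq_of_isotropic_of_orthogonal_of_card (c.compr₂ ω) hX hinjL hinjR S T
    (fun s hs t ht ↦ by rw [hb, hST s hs t ht, map_zero]) (fun s hs s' hs' ↦ by rw [hb, hSS s hs s' hs', map_zero])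
    hcard hST'

end LagrangianComp

/-! ## §2 A hyperbolic plane over `𝔽_p` (`p` odd) has exactly two isotropic lines -/

section Plane

variable {X : Type*} [AddCommGroup X] {p : ℕ} [hp : Fact p.Prime]

/-- In a group of order `p`, a non-zero element generates: every element is an integer multiple of it.
[cite: Serre1973, Ch. I §1 (folklore)] -/
theorem exists_zsmul_eq_of_card_eq_prime {M : AddSubgroup X} (hM : Nat.card M = p) {e : X} (he : e ∈ M)
    (he0 : e ≠ 0) (m : X) (hm : m ∈ M) : ∃ k : ℤ, k • e = m := by
  have hgen : (⟨m, hm⟩ : M) ∈ AddSubgroup.zmultiples (⟨e, he⟩ : M) :=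
    mem_zmultiples_of_prime_card hM (fun h ↦ he0 (congrArg Subtype.val h))
  obtain ⟨k, hk⟩ := AddSubgroup.mem_zmultiples_iff.mp hgen
  exact ⟨k, by simpa using congrArg Subtype.val hk⟩

/-- A subgroup of order `p` containing a subgroup of order `p`… : two subgroups of the same prime order, one inside the
other, are equal; contrapositively, if `S ≠ M` have order `p` then an element of `S ∖ {0}`… — here: `S ≤ M`, `#S = #M`
finite ⇒ `S = M`. [cite: Serre1973, Ch. I §1 (folklore)] -/
theorem eq_of_le_of_card_eq {S M : AddSubgroup X} [Finite M] (hle : S ≤ M) (h : Nat.card S = Nat.card M) : S = M :=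
  AddSubgroup.eq_of_le_of_card_ge hle h.ge

/-- **Decomposition of a group of order `p²` killed by `p`**: if `#X = p²`, `M ≤ X` has order `p` with generator `e`, and
`x ∉ M`, then every element of `X` is `i • e + j • x` for some integers `i, j`. [cite: Serre1973, Ch. IV §1.3 (folklore)] -/
theorem exists_zsmul_add_zsmul_eq_of_card_eq_sq [Finite X] (hcard : Nat.card X = p ^ 2) {M : AddSubgroup X}
    (hM : Nat.card M = p) {e : X} (he : e ∈ M) (he0 : e ≠ 0) {x : X} (hx : x ∉ M) (y : X) :
    ∃ i j : ℤ, i • e + j • x = y := by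
  -- the subgroup generated by `e` and `x` is everything, by Lagrange
  set H : AddSubgroup X := AddSubgroup.zmultiples e ⊔ AddSubgroup.zmultiples x with hH
  have hMle : M ≤ H := fun m hm ↦ by
    obtain ⟨k, rfl⟩ := exists_zsmul_eq_of_card_eq_prime hM he he0 m hm
    exact AddSubgroup.mem_sup_left (AddSubgroup.zsmul_mem _ (AddSubgroup.mem_zmultiples e) k)
  have hxH : x ∈ H := AddSubgroup.mem_sup_right (AddSubgroup.mem_zmultiples x)
  have hHdvd : Nat.card H ∣ p ^ 2 := hcard ▸ AddSubgroup.card_addSubgroup_dvd_card H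
  obtain ⟨i, hi, hHi⟩ := (Nat.dvd_prime_pow hp.out).mp hHdvd
  have hMH : M ≠ H := fun h ↦ hx (h ▸ hxH)
  have hHtop : H = ⊤ := by
    interval_cases i
    · -- `#H = 1`: impossible, `e ≠ 0`
      exfalso
      rw [pow_zero] at hHi
      have hsub : Subsingleton H := (Nat.card_eq_one_iff_unique.mp hHi).1
      have heH : (⟨e, hMle he⟩ : H) = 0 := Subsingleton.elim _ _
      exact he0 (congrArg Subtype.val heH)
    · -- `#H = p = #M`: then `M = H`, contradiction
      exfalso
      rw [pow_one] at hHi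
      exact hMH (eq_of_le_of_card_eq hMle (hM.trans hHi.symm))
    · exact (AddSubgroup.card_eq_iff_eq_top H).mp (hHi.trans hcard.symm)
  have hy : y ∈ H := hHtop ▸ AddSubgroup.mem_top y
  rw [hH, AddSubgroup.mem_sup] at hy
  obtain ⟨a, ha, c, hc, rfl⟩ := hy
  obtain ⟨i, rfl⟩ := AddSubgroup.mem_zmultiples_iff.mp ha
  obtain ⟨j, rfl⟩ := AddSubgroup.mem_zmultiples_iff.mp hc
  exact ⟨i, j, rfl⟩

/-- **A hyperbolic plane has exactly two isotropic lines.**  Let `X` be killed by the odd prime `p` with `#X = p²`, `b` a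
SYMMETRIC bi-additive pairing `X × X → ℤ/p` with injective adjoint, and `M ≤ X` an ISOTROPIC subgroup of order `p`.  Then
any two isotropic subgroups `S, T` of order `p` different from `M` coincide: writing `X = ℤe ⊕ ℤs` (`e` generating `M`,
`s` generating `S`), `β := b(e, s) ≠ 0` by non-degeneracy, and `t = i e + j s` (`p ∤ j`) is isotropic iff `2 i j β = 0`
iff `p ∣ i`, i.e. `t ∈ S`. [cite: Serre1973, Ch. IV §1.3 (hyperbolic planes)] [cite: MilneADT2006, Ch. I §0] -/
theorem eq_of_isotropic_of_ne_of_card_eq_sq [Finite X] (hp2 : p ≠ 2) (b : X →+ X →+ ZMod p)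
    (hX : ∀ x : X, p • x = 0) (hsymm : ∀ x y : X, b x y = b y x) (hinj : Injective b)
    (hcard : Nat.card X = p ^ 2) (M S T : AddSubgroup X) (hM : Nat.card M = p) (hS : Nat.card S = p)
    (hT : Nat.card T = p) (hMiso : ∀ x ∈ M, ∀ y ∈ M, b x y = 0) (hSiso : ∀ x ∈ S, ∀ y ∈ S, b x y = 0)
    (hTiso : ∀ x ∈ T, ∀ y ∈ T, b x y = 0) (hSM : S ≠ M) (hTM : T ≠ M) : S = T := by
  haveI : Finite M := Finite.of_injective _ (AddSubgroup.subtype_injective M)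
  haveI : Finite S := Finite.of_injective _ (AddSubgroup.subtype_injective S)
  haveI : Finite T := Finite.of_injective _ (AddSubgroup.subtype_injective T)
  -- generators: `e` of `M`, `s` of `S`, `t` of `T`
  have hne : ∀ {N : AddSubgroup X}, Nat.card N = p → ∃ g ∈ N, g ≠ 0 := fun {N} hN ↦ by
    by_contra h
    push Not at h
    have hsub : Subsingleton N := ⟨fun a c ↦ Subtype.ext ((h a a.2).trans (h c c.2).symm)⟩
    have h1 : Nat.card N = 1 := Nat.card_eq_one_iff_unique.mpr ⟨hsub, ⟨0⟩⟩
    exact hp.out.one_lt.ne (h1.symm.trans hN)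
  obtain ⟨e, he, he0⟩ := hne hM
  obtain ⟨s, hs, hs0⟩ := hne hS
  obtain ⟨t, ht, ht0⟩ := hne hT
  -- `s ∉ M`, `t ∉ M` (else `S ≤ M`, `S = M`)
  have hnot : ∀ {N : AddSubgroup X} {g : X}, Nat.card N = p → g ∈ N → g ≠ 0 → N ≠ M → g ∉ M :=
    fun {N} {g} hN hg hg0 hNM hgM ↦ hNM (eq_of_le_of_card_eq (fun y hy ↦ by
      obtain ⟨k, rfl⟩ := exists_zsmul_eq_of_card_eq_prime hN hg hg0 y hy
      exact AddSubgroup.zsmul_mem _ hgM k) (hN.trans hM.symm))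
  have hsM : s ∉ M := hnot hS hs hs0 hSM
  have htM : t ∉ M := hnot hT ht ht0 hTM
  -- bilinearity bookkeeping
  have hbz : ∀ (i j : ℤ) (x y : X), b (i • x) (j • y) = ((i * j : ℤ) : ZMod p) * b x y := fun i j x y ↦ by
    have h1 : b (i • x) (j • y) = j • b (i • x) y := map_zsmul (b (i • x)) j y
    have h2 : b (i • x) y = i • b x y := by
      change b.flip y (i • x) = i • b.flip y x
      exact map_zsmul (b.flip y) i x
    rw [h1, h2, smul_smul, ← Int.cast_smul_eq_zsmul (ZMod p) (j * i), smul_eq_mul, mul_comm j i]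
  -- `β = b(e, s) ≠ 0`
  have hβ : b e s ≠ 0 := by
    intro hβ
    apply he0
    apply hinj
    rw [map_zero]
    refine AddMonoidHom.ext fun y ↦ ?_
    obtain ⟨i, j, rfl⟩ := exists_zsmul_add_zsmul_eq_of_card_eq_sq hcard hM he he0 hsM y
    rw [AddMonoidHom.zero_apply, map_add, map_zsmul, map_zsmul, hMiso e he e he, hβ, zsmul_zero, zsmul_zero,
      add_zero]
  -- `t = i e + j s` with `p ∤ j`
  obtain ⟨i, j, hij⟩ := exists_zsmul_add_zsmul_eq_of_card_eq_sq hcard hM he he0 hsM t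
  have hpe : ∀ (k : ℤ) (x : X), (p : ℤ) ∣ k → k • x = 0 := fun k x ⟨c, hc⟩ ↦ by
    rw [hc, mul_comm, mul_zsmul, natCast_zsmul, hX, zsmul_zero]
  have hj : ¬ (p : ℤ) ∣ j := fun hdj ↦ htM (by
    rw [← hij, hpe j s hdj, add_zero]
    exact AddSubgroup.zsmul_mem _ he i)
  -- isotropy of `t`: `2 i j β = 0`
  have htt : b t t = 0 := hTiso t ht t ht
  have hexp : b (i • e + j • s) (i • e + j • s) = ((2 * (i * j) : ℤ) : ZMod p) * b e s := by
    rw [b.map_add, AddMonoidHom.add_apply, (b (i • e)).map_add, (b (j • s)).map_add, hbz, hbz, hbz, hbz,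
      hMiso e he e he, hSiso s hs s hs, mul_zero, mul_zero, zero_add, add_zero, hsymm s e, ← add_mul,
      ← Int.cast_add, mul_comm j i, ← two_mul]
  rw [← hij, hexp] at htt
  have h2ij : ((2 * (i * j) : ℤ) : ZMod p) = 0 := by
    rcases mul_eq_zero.mp htt with h | h
    · exact h
    · exact absurd h hβ
  rw [ZMod.intCast_zmod_eq_zero_iff_dvd] at h2ij
  have hpi : (p : ℤ) ∣ i := by
    have hp' : Prime (p : ℤ) := Nat.prime_iff_prime_int.mp hp.out
    rcases hp'.dvd_or_dvd h2ij with h2 | hij'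
    · exfalso
      have : (p : ℤ) ∣ 2 := h2
      have hle : p ≤ 2 := Nat.le_of_dvd two_pos (by exact_mod_cast this)
      exact hp2 (le_antisymm hle hp.out.two_le)
    · rcases hp'.dvd_or_dvd hij' with hi | hj'
      · exact hi
      · exact absurd hj' hj
  -- hence `t = j s ∈ S`, so `T ≤ S`, so `T = S`
  have htS : t ∈ S := by
    rw [← hij, hpe i e hpi, zero_add]
    exact AddSubgroup.zsmul_mem _ hs j
  exact (eq_of_le_of_card_eq (S := T) (M := S) (fun y hy ↦ by
    obtain ⟨k, rfl⟩ := exists_zsmul_eq_of_card_eq_prime hT ht ht0 y hy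
    exact AddSubgroup.zsmul_mem _ htS k) (hT.trans hS.symm)).symm

end Plane

end Literature.NumberTheory.GaloisRepresentations

end
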